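import Summits.QuantumFields.YangMills.Theorems.UV3BranchExpansionRestrictedDensity
import Summits.QuantumFields.YangMills.Theorems.UV3BranchExpansionDomination
import HarnessLib

/-!
# R3 (cell `ym3-torus`, YM₃ on T³ — a ladder RUNG, NOT d = 4, NOT infinite volume, NOT a mass gap, NOT the Clay problem) —
# **(A₃-concrete) THE STACKED ACTIVITY OF A BRANCH: along the hybrid trajectory of a history `(s, s′)` the push-forward of product Haar
# restricted to «every constrained guard fires» is dominated by coarse product Haar with the product of the one-level constants
# `K^{|s′_n|}·dU_{j+n}(Adm_{s_n})`**

Width seat `ym-ust-19936-w8` g12 on crux `stmt-QuantumFields-19936` `UnitScaleTilt.HistoryTailL` (`--supports`, helper; THEOREMS ONLY, 0 `def`, 0 `sorry`).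
LEAD ★w1 g12's note `Cruxes/HistoryTailL/HTopBranchExpansion.md` §3 (A₃) «GO (A₃-concrete)» (bus 03:34:10Z): the abstract stacking ✓`UV3BranchExpansionDomination.
map_restrict_iterate_le_prod_smul_of_lt` (p758782) INSTANTIATED at the gauge-field levels `X n := GaugeField P (j+n) G`, `λ_n := dU_{j+n}`, the hybrid one-step maps
`T_n := Ū^{s′_n}` (print's (0.4) averaging on `s′_n`, the straight transporter off it), the guard events `E_n := G_{s_n}`, and the one-level constants of ✓(A₁)
`UV3BranchExpansionRestrictedDensity.map_restrict_guardAll_hybrid_le` (p758345).  The HISTORY LETTERS fixed here (def-free): `s s′ : (n : ℕ) → Finset (PBond P (j+n+1))`,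
`s′ n ⊆ s n`; the trajectory `V : (n : ℕ) → GaugeField P j G → GaugeField P (j+n) G` by the hypotheses `hV0 : V 0 U = U`, `hVs : V (n+1) U = Ū^{s′ n}(V n U)`
(`j + (n+1)` and `j + n + 1` agree by `rfl`); standing range `j + N ≤ m + K` for the traversed levels only.
RECORD CURRENCY (★★OWNER WORDS 84 (2) ∕ 85 (4) ∕ ACK 145): record-independent kinematics of product Haar and the guarded averaging; SUPPLY-side for the hTop-class rows
`fibre55Win` ∕ `fibre57LowOn` of the χ record inside NODE O B3 and for Track A's N08 — NOT a 19936 registry row.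

CONTENTS.  ★★★ `map_restrict_traj_le_prod_smul` — `((dU_j)↾{∀ n < N, V n U ∈ G_{s n}}).map (V N) ≤ (Π_{n<N} K^{|s′ n|}·dU_{j+n}(Adm_{s n})) • dU_{j+N}`;
★★ `map_restrict_traj_le_pow_smul` — with a per-level admitting bound `dU_{j+n}(Adm_S) ≤ q^{|S|}`: `≤ (Π_{n<N} K^{|s′ n|}·q^{|s n|}) • dU_{j+N}` (the weight
`μ_{𝐬,𝐬′} ≤ Π_n K^{|s′_n|} q^{|s_n|} • dU` of the note's §3); `measurable_traj` (the trajectory is measurable).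

HONEST SCOPE.  Bookkeeping over ✓p758345 and ✓p758782 BY NAME; (H_K) and the admitting bound `q` are HYPOTHESES (discharged elsewhere: ✓`…GuardCoreLawSU2`,
✓`…GuardAdmitting.measure_forall_guardAdmitting_le`); nothing of (M) ∕ (C) ∕ hTop ∕ (T8) ∕ (O‴χₛ) ∕ `HistoryTailL` (19936) ∕ the rung ∕ d = 4 ∕ a mass gap ∕ Clay is proved.
YM₃ on T³ is rung R3 of the ladder, not the Clay problem.

References: T. Bałaban, Commun. Math. Phys. **109** (1987) 249–301 [Balaban1987RG1] ((0.4) p. 253); T. Bałaban, Commun. Math. Phys. **98** (1985) 17–51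
[Balaban1985Averaging] ((10) p. 19); T. Bałaban, Commun. Math. Phys. **102** (1985) 255–275 [Balaban1985UV3] ((2) p. 256, the k-fold transport).
-/

set_option autoImplicit false

noncomputable section

open MeasureTheory Function
open scoped ENNReal

namespace Summit.QuantumFields.YangMills.Theorems.UV3BranchExpansionStackedActivity

open Literature.MathematicalPhysics.QuantumFieldTheory.Balaban1983to89
open Literature.MathematicalPhysics.QuantumFieldTheory.Balaban1983to89.AveragingRT (axialAvg)
open Literature.MathematicalPhysics.QuantumFieldTheory.Balaban1983to89.BlockAveraging (Small avgFun)
open Literature.MathematicalPhysics.QuantumFieldTheory.Balaban1983to89.BlockAveragingHaarAC (centralBond)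
open Summit.QuantumFields.YangMills.BalabanUVNodes.N08HaarCompatibilityGuardHybridPartition (measurable_hybrid measurableSet_guardAll)
open Summit.QuantumFields.YangMills.Theorems.UV3BranchExpansionRestrictedDensity (map_restrict_guardAll_hybrid_le)
open Summit.QuantumFields.YangMills.Theorems.UV3BranchExpansionDomination (map_restrict_iterate_le_prod_smul_of_lt measurable_iterate)

variable {P : Params} {j : ℕ} {G : Type*} [GaugeGroup G] (ℰ : LoopAverage G) [MeasurableSpace G] [RegularGaugeGroup G] [HaarData G]

omit [HaarData G] in
/-- The hybrid trajectory of a history is measurable at every height. [folklore] -/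
theorem measurable_traj (hE : ∀ n, Measurable fun W : Fin (n + 1) → G => ℰ.E W)
    (s' : (n : ℕ) → Finset (PBond P (j + n + 1))) (V : (n : ℕ) → GaugeField P j G → GaugeField P (j + n) G)
    (hV0 : ∀ U, V 0 U = U)
    (hVs : ∀ n U, V (n + 1) U = (fun c => if c ∈ s' n then avgFun ℰ (V n U) c else axialAvg (V n U) c : GaugeField P (j + n + 1) G)) :
    ∀ n, Measurable (V n) :=
  measurable_iterate (X := fun n => GaugeField P (j + n) G)
    (fun n => fun U : GaugeField P (j + n) G => (fun c => if c ∈ s' n then avgFun ℰ U c else axialAvg U c : GaugeField P (j + n + 1) G))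
    V (fun n => measurable_hybrid ℰ hE (s' n)) hV0 hVs

/-- ★★★ **(A₃-concrete) THE STACKED ACTIVITY.**  History `(s, s′)` with `s′ n ⊆ s n` (guards constrained to fire ⊇ EML branches) at the levels `j … j+N` of the standing range
(`j + N ≤ m + K`); trajectory `V` of the hybrids `Ū^{s′ n}`; a constant `K ∈ [1, ∞)` dominating print's fibre laws on the admitting backgrounds of every bond of every `s′ n`
((H_K), n08-w3's letter).  Then the push-forward of `dU_j` restricted to «for every `n < N` every guard of `s n` fires at height `n`» under `V N` is dominated by
`(Π_{n<N} K^{|s′ n|} · dU_{j+n} {U | ∀ c ∈ s n, ∃ g, Small ℰ (U[β(c) ↦ g]) c}) • dU_{j+N}` — ✓(A₃′) stacked over ✓(A₁). [cite: Balaban1987RG1, (0.4) p.253; Balaban1985UV3, (2) p.256] -/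
theorem map_restrict_traj_le_prod_smul (hE : ∀ n, Measurable fun W : Fin (n + 1) → G => ℰ.E W) (N : ℕ) (hN : j + N ≤ P.m + P.K)
    (s s' : (n : ℕ) → Finset (PBond P (j + n + 1))) (hs' : ∀ n, s' n ⊆ s n)
    (V : (n : ℕ) → GaugeField P j G → GaugeField P (j + n) G) (hV0 : ∀ U, V 0 U = U)
    (hVs : ∀ n U, V (n + 1) U = (fun c => if c ∈ s' n then avgFun ℰ (V n U) c else axialAvg (V n U) c : GaugeField P (j + n + 1) G))
    {K : ℝ≥0∞} (hK1 : 1 ≤ K) (hKtop : K ≠ ∞)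
    (hK : ∀ n, ∀ c ∈ s' n, ∀ U : GaugeField P (j + n) G, (∃ g : G, Small ℰ (update U (centralBond c) g) c) →
      (HaarData.haar : Measure G).map (fun g => avgFun ℰ (update U (centralBond c) g) c) ≤ K • (HaarData.haar : Measure G)) :
    ((fieldMeasure P j G).restrict {U : GaugeField P j G | ∀ n < N, ∀ c ∈ s n, Small ℰ (V n U) c}).map (V N) ≤
      (∏ n ∈ Finset.range N, K ^ (s' n).card *
          fieldMeasure P (j + n) G {U : GaugeField P (j + n) G | ∀ c ∈ s n, ∃ g : G, Small ℰ (update U (centralBond c) g) c}) •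
        fieldMeasure P (j + N) G := by
  have h := map_restrict_iterate_le_prod_smul_of_lt (X := fun n => GaugeField P (j + n) G)
    (fun n => fieldMeasure P (j + n) G)
    (fun n => fun U : GaugeField P (j + n) G => (fun c => if c ∈ s' n then avgFun ℰ U c else axialAvg U c : GaugeField P (j + n + 1) G))
    (fun n => {U : GaugeField P (j + n) G | ∀ c ∈ s n, Small ℰ U c}) V
    (fun n => measurable_hybrid ℰ hE (s' n)) (fun n => measurableSet_guardAll ℰ (s n)) hV0 hVs
    (fun n => K ^ (s' n).card * fieldMeasure P (j + n) G {U : GaugeField P (j + n) G | ∀ c ∈ s n, ∃ g : G, Small ℰ (update U (centralBond c) g) c})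
    N (fun n hn => map_restrict_guardAll_hybrid_le ℰ (by omega) hE (s n) (s' n) (hs' n) hK1 hKtop (hK n))
  exact h

/-- ★★ **THE STACKED ACTIVITY WITH A PER-LEVEL ADMITTING BOUND**: if moreover the guard-admitting backgrounds of every finset `S` at every traversed level have measure
`≤ q^{|S|}` (n08-w3 part 19's ✓`measure_forall_guardAdmitting_le` supplies `q = h(δ+δ′)^{L^{d−1}−1} ∕ h(δ′)`), then the restricted push-forward is
`≤ (Π_{n<N} K^{|s′ n|} · q^{|s n|}) • dU_{j+N}` — the weight of the branch `(𝐬, 𝐬′)` in LEAD's note §3. [cite: Balaban1987RG1, (0.4) p.253; Balaban1985UV3, (2) p.256] -/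
theorem map_restrict_traj_le_pow_smul (hE : ∀ n, Measurable fun W : Fin (n + 1) → G => ℰ.E W) (N : ℕ) (hN : j + N ≤ P.m + P.K)
    (s s' : (n : ℕ) → Finset (PBond P (j + n + 1))) (hs' : ∀ n, s' n ⊆ s n)
    (V : (n : ℕ) → GaugeField P j G → GaugeField P (j + n) G) (hV0 : ∀ U, V 0 U = U)
    (hVs : ∀ n U, V (n + 1) U = (fun c => if c ∈ s' n then avgFun ℰ (V n U) c else axialAvg (V n U) c : GaugeField P (j + n + 1) G))
    {K : ℝ≥0∞} (hK1 : 1 ≤ K) (hKtop : K ≠ ∞)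
    (hK : ∀ n, ∀ c ∈ s' n, ∀ U : GaugeField P (j + n) G, (∃ g : G, Small ℰ (update U (centralBond c) g) c) →
      (HaarData.haar : Measure G).map (fun g => avgFun ℰ (update U (centralBond c) g) c) ≤ K • (HaarData.haar : Measure G))
    (q : ℝ≥0∞) (hq : ∀ n < N, ∀ S : Finset (PBond P (j + n + 1)),
      fieldMeasure P (j + n) G {U : GaugeField P (j + n) G | ∀ c ∈ S, ∃ g : G, Small ℰ (update U (centralBond c) g) c} ≤ q ^ S.card) :
    ((fieldMeasure P j G).restrict {U : GaugeField P j G | ∀ n < N, ∀ c ∈ s n, Small ℰ (V n U) c}).map (V N) ≤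
      (∏ n ∈ Finset.range N, K ^ (s' n).card * q ^ (s n).card) • fieldMeasure P (j + N) G := by
  refine (map_restrict_traj_le_prod_smul ℰ hE N hN s s' hs' V hV0 hVs hK1 hKtop hK).trans ?_
  refine Measure.le_iff.2 fun B _ => ?_
  rw [Measure.smul_apply, Measure.smul_apply, smul_eq_mul, smul_eq_mul]
  refine mul_le_mul' (Finset.prod_le_prod' fun n hn => mul_le_mul' le_rfl (hq n (Finset.mem_range.1 hn) (s n))) le_rfl

end Summit.QuantumFields.YangMills.Theorems.UV3BranchExpansionStackedActivity

end
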